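import Mathlib
import HarnessLib
import Summits.HubbardSuperconductivity.HubbardSuperconductivity.Theorems.KLProgrammeKLRegimeFlowReadResidueOsc
import Summits.HubbardSuperconductivity.HubbardSuperconductivity.Theorems.KLProgrammeKLRegimeCountertermJacksonRemainderReadResidueC1Tables

/-!
# Route `KLProgramme`, crux K3 — gen-8 ENGINE-FLOW child (stmt-HubbardSuperconductivity-20437 `KLRegimeEngineV17F2`), stub (C)
# `stub_twoLeg_curvature`, v2 conjunct `TwoLegReadOscAt`: the (C1) JACKSON-REMAINDER ROW in the mean-free clause's currency — «(C1)-OSC»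

Seat hubbard-kl-k3c3-p1 (g10; row «δμ-flow with klAngularMean constant piece»).  Companion of `…FlowReadResidueOsc` («(P)-OSC», p595978): the (C1)
bracket `J(θ) = ν_n(K_n)(θ) − (klFlowPiece n).eval (k_F^{K_{n+1}} θ)` enters the structured residue door `readResidue_flow_structured` through a bound
`|J(θ)| ≤ j·U²·4^{−2(n+1)}`.  The one-call (C1) door of record (`readResidueC1_jets_of_twoLegReadJetBound(_klEng_of_le)`, p586985/p591265) returns the
VALUE ROW `|J(θ)| ≤ bar₁(n)·Td + (π/2)·bar₁(n)·N0` with `bar₁(n) = curveJetBar cc cc′ U 1 n = (cc₁ + cc′₁|U|)·U²·4^{−n}` (the slope of the induction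
hypothesis: the Jackson remainder sees only the MEAN-FREE part of the reading, whose sup is `≤ (π/2)·sup|∂_θ ν_n|`; the θ-constant first-order part is
reproduced exactly).  In the clause's currency this is

  `|J(θ)| ≤ [16·4ⁿ·(Td + (π/2)·N0)·(cc₁ + cc′₁|U|)] · U² · 4^{−2(n+1)}`,

`n`-uniform along the degree schedule `d_n = klFlowDeg n = 128·4ⁿ` (`Td ~ 1/d_n`, `N0 ≤ π³/(4((d_n+1)δ)³)`): the bracket is `≤ 1.011·(cc₁ + cc′₁|U|)` at
`d = 128` (refined record) and `≤ 0.16 / 0.255 / 0.171 / 0.253·(…)` at `d = 512 / 2048 / 8192 / 32768` (§3; exact arithmetic on the record tables,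
`π < 3.1416`), against the clause's budget `klC4aJetC′ P R 0 = 2^20·(klEngQ5 P R).S′ 0`.

* §1 `curveJetBar_one_mul_eq_osc` (the rescaling identity), `abs_le_osc_of_value_row` (value row ⇒ clause currency), `abs_le_osc_of_jets_fst_eq_zero`
  (any `curveJetBar e e′` jet table with `e 0 = 0` ⇒ clause currency — serves the TAB-FIT / AN-FIT doors and the (C2) door `transport_jets_flow_fit` alike);
* §2 **`readResidueC1_osc_of_twoLegReadJetBound`** (explicit thresholds) and **`…_klEng_of_le`** (stub binders, `n + 1 ≤ 21`): the (C1) row of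
  `readResidue_flow_structured` / `twoLegReadOscAt_flow_succ_of_doors_klReadOscC` from the regime, `FrameOK … K_{n+1}`, the certificate and the IH;
* §3 the five record numerals `osc_coeff_table128r/512/2048/8192/32768_le`.

Bookkeeping + arithmetic only; no definition; the certificate Props stay hypotheses; nothing here asserts any stub of 20437, K3 or superconductivity.
References: BGM 2006 §2.4 (2.36) [cite: BenfattoGiulianiMastropietro2006].
-/

noncomputable section

namespace Summit.HubbardSuperconductivity.HubbardSuperconductivity.Theorems.KLRegimeSplit

set_option linter.dupNamespace false -- summit = problem name (single-conjunct summit), D-0017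

open Real
open Literature.MathematicalPhysics.QuantumLattice Literature.Probability.LatticeModels
open Summit.HubbardSuperconductivity.HubbardSuperconductivity.Theorems.PerturbedFermiCurve
open Summit.HubbardSuperconductivity.HubbardSuperconductivity.Theorems.EngineV8

/-! ## §1 The rescaling identity and the two conversions -/

/-- **Rescaling**: `curveJetBar cc cc′ U 1 n · X = [16·4ⁿ·X·(cc₁ + cc′₁|U|)]·U²·4^{−2(n+1)}` (slope law at scale `n` → value law at scale `n+1`). -/
theorem curveJetBar_one_mul_eq_osc (cc cc' : ℕ → ℝ) (U X : ℝ) (n : ℕ) :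
    curveJetBar cc cc' U 1 n * X = (16 * (4 : ℝ) ^ n * X * (cc 1 + cc' 1 * |U|)) * U ^ 2 * (4 : ℝ) ^ (-2 * ((n + 1 : ℕ) : ℤ)) := by
  have h1 : (4 : ℝ) ^ ((((1 : ℕ) : ℤ) - 2) * (n : ℤ)) = ((4 : ℝ) ^ n)⁻¹ := by
    rw [show (((1 : ℕ) : ℤ) - 2) * (n : ℤ) = -(n : ℤ) by push_cast; ring, zpow_neg, zpow_natCast]
  have h2 : (4 : ℝ) ^ (-2 * ((n + 1 : ℕ) : ℤ)) = ((4 : ℝ) ^ (n + 1) * (4 : ℝ) ^ (n + 1))⁻¹ := by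
    rw [show -2 * ((n + 1 : ℕ) : ℤ) = -(((n + 1) + (n + 1) : ℕ) : ℤ) by push_cast; ring, zpow_neg, zpow_natCast, pow_add]
  rw [curveJetBar_apply, h1, h2]
  simp only [uPow, one_ne_zero, if_false]
  have h4 : (4 : ℝ) ^ n ≠ 0 := pow_ne_zero _ (by norm_num)
  field_simp
  ring

/-- **Value row ⇒ clause currency**: `|x| ≤ bar₁(n)·Td + (π/2)·bar₁(n)·N0` ⟹ `|x| ≤ [16·4ⁿ·(Td + (π/2)N0)·(cc₁ + cc′₁|U|)]·U²·4^{−2(n+1)}`. -/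
theorem abs_le_osc_of_value_row {x U Td N0 : ℝ} {cc cc' : ℕ → ℝ} {n : ℕ}
    (h : |x| ≤ curveJetBar cc cc' U 1 n * Td + π / 2 * curveJetBar cc cc' U 1 n * N0) :
    |x| ≤ (16 * (4 : ℝ) ^ n * (Td + π / 2 * N0) * (cc 1 + cc' 1 * |U|)) * U ^ 2 * (4 : ℝ) ^ (-2 * ((n + 1 : ℕ) : ℤ)) := by
  have heq : curveJetBar cc cc' U 1 n * Td + π / 2 * curveJetBar cc cc' U 1 n * N0 = curveJetBar cc cc' U 1 n * (Td + π / 2 * N0) := by ring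
  rw [heq, curveJetBar_one_mul_eq_osc] at h
  exact h

/-- **Any jet table with zero un-primed `k = 0` entry ⇒ clause currency**: `|∂ᵏf| ≤ curveJetBar e e′ U k m` (`k ≤ 4`), `e 0 = 0` ⟹ `|f θ| ≤ e′0·U²·4^{−2m}`
(the TAB-FIT / AN-FIT (C1) doors and the (C2) door `transport_jets_flow_fit` are of this shape). -/
theorem abs_le_osc_of_jets_fst_eq_zero {f : ℝ → ℝ} {e e' : ℕ → ℝ} {U : ℝ} {m : ℕ}
    (h : ∀ k ≤ 4, ∀ θ : ℝ, |iteratedDeriv k f θ| ≤ curveJetBar e e' U k m) (he : e 0 = 0) (θ : ℝ) :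
    |f θ| ≤ e' 0 * U ^ 2 * (4 : ℝ) ^ (-2 * (m : ℤ)) := by
  have h0 := h 0 (Nat.zero_le _) θ
  rw [iteratedDeriv_zero] at h0
  exact abs_le_of_curveJetBar_zero_of_fst_eq_zero he h0

/-! ## §2 The (C1) row of the structured residue door -/

section Model

variable {L M : ℕ} [NeZero L] [NeZero M]

/-- **THE (C1) ROW IN THE CLAUSE's CURRENCY** (explicit thresholds `klCurveC3/klCurveU0`, abstract frame-size table `A`): from the regime, `FrameOK … K_{n+1}`, the
certificate `CutoffDefectCertFrame (klFlowDeg n) A T`, frame sizes `≤ A` and the IH `TwoLegReadJetBound L M cc cc' β U μ K_n n` (`cc, cc' ≥ 0`):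
`|J(θ)| ≤ [16·4ⁿ·(T.Td + (π/2)T.N0)·(cc₁ + cc′₁|U|)]·U²·4^{−2(n+1)}`. -/
theorem readResidueC1_osc_of_twoLegReadJetBound {R : RenConsts} (hR : ∀ j, 0 ≤ R.Gfr j) {c : ℝ} (hc : 0 < c) (hcle : c ≤ klCurveC3 R)
    {U : ℝ} (hU : 0 < U) (hUle : U ≤ klCurveU0 R) {β : ℝ} (hβmin : klBetaMin ≤ β) (hβc : β ≤ Real.exp (c / U ^ 2))
    {μ : ℝ} (hμ : μ ∈ klWindowC) {n : ℕ} (hK : FrameOK R U (nScales β) μ (klFlowFrameU L M β U μ (n + 1)))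
    {d : ℕ} (hd : klFlowDeg n = d) {A : ℕ → ℝ} {T : CutoffDefectTable} (hcert : CutoffDefectCertFrame d A T)
    (hA : ∀ j ≤ 4, ∀ p : EuclideanSpace ℝ (Fin 2),
      ‖iteratedFDeriv ℝ j (fun q : EuclideanSpace ℝ (Fin 2) => (klFlowFrameU L M β U μ (n + 1)).eval (WithLp.ofLp q)) p‖ ≤ A j)
    {cc cc' : ℕ → ℝ} (hcc : ∀ k, 0 ≤ cc k) (hcc' : ∀ k, 0 ≤ cc' k)
    (hIH : TwoLegReadJetBound L M cc cc' β U μ (klFlowFrameU L M β U μ n) n) (θ : ℝ) :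
    |klLocalPart L M β U μ (klFlowFrameU L M β U μ n) n θ -
        (klFlowPiece L M β U μ n).eval (klFermiPoint μ (klFlowFrameU L M β U μ (n + 1)) θ)| ≤
      (16 * (4 : ℝ) ^ n * (T.Td + π / 2 * T.N0) * (cc 1 + cc' 1 * |U|)) * U ^ 2 * (4 : ℝ) ^ (-2 * ((n + 1 : ℕ) : ℤ)) :=
  abs_le_osc_of_value_row ((readResidueC1_jets_of_twoLegReadJetBound hR hc hcle hU hUle hβmin hβc hμ hK hd hcert hA hcc hcc' hIH).2.1 θ)

/-- **THE (C1) ROW IN THE CLAUSE's CURRENCY AT STUB (C)'s BINDERS** (`R.WF`, `c ≤ klEngC₃6 P R`, `U ≤ klEngU₀9 P R c`, `n + 1 ≤ 21`, history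
`FlowPieceJetsAt … m` for `m ≤ n`, any certificate size table `A ≥ 10⁻¹²` — all records): the `hJ` input of `twoLegReadOscAt_flow_succ_of_doors_klReadOscC`
with `j := 16·4ⁿ·(T.Td + (π/2)T.N0)·(cc₁ + cc′₁|U|)`. -/
theorem readResidueC1_osc_of_twoLegReadJetBound_klEng_of_le {P : SplitConsts} {R : RenConsts} (hRW : R.WF) {c : ℝ} (hc : 0 < c)
    (hc6 : c ≤ klEngC₃6 P R) {μ : ℝ} (hμ : μ ∈ klWindowC) {U : ℝ} (hU : 0 < U) (hU9 : U ≤ klEngU₀9 P R c) {β : ℝ}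
    (hβmin : klBetaMin ≤ β) (hβc : β ≤ Real.exp (c / U ^ 2)) {n : ℕ} (hn : n + 1 ≤ 21)
    (hK : FrameOK R U (nScales β) μ (klFlowFrameU L M β U μ (n + 1))) (hist : ∀ m < n + 1, FlowPieceJetsAt L M β U μ R m)
    {d : ℕ} (hd : klFlowDeg n = d) {A : ℕ → ℝ} {T : CutoffDefectTable} (hcert : CutoffDefectCertFrame d A T)
    (hA12 : ∀ j ≤ 4, (1 : ℝ) / 10 ^ 12 ≤ A j)
    {cc cc' : ℕ → ℝ} (hcc : ∀ k, 0 ≤ cc k) (hcc' : ∀ k, 0 ≤ cc' k)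
    (hIH : TwoLegReadJetBound L M cc cc' β U μ (klFlowFrameU L M β U μ n) n) (θ : ℝ) :
    |klLocalPart L M β U μ (klFlowFrameU L M β U μ n) n θ -
        (klFlowPiece L M β U μ n).eval (klFermiPoint μ (klFlowFrameU L M β U μ (n + 1)) θ)| ≤
      (16 * (4 : ℝ) ^ n * (T.Td + π / 2 * T.N0) * (cc 1 + cc' 1 * |U|)) * U ^ 2 * (4 : ℝ) ^ (-2 * ((n + 1 : ℕ) : ℤ)) :=
  abs_le_osc_of_value_row
    ((readResidueC1_jets_of_twoLegReadJetBound_klEng_of_le hRW hc hc6 hμ hU hU9 hβmin hβc hn hK hist hd hcert hA12 hcc hcc' hIH).2.1 θ)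

end Model

/-! ## §3 The five record numerals: `16·4ⁿ·(Td + (π/2)·N0)` along the table branch -/

/-- `d = 128` (refined record, `n = 0`): `16·(Td + (π/2)N0) ≤ 1.011`. -/
theorem osc_coeff_table128r_le : 16 * (4 : ℝ) ^ 0 * (klC1TableF128r.Td + π / 2 * klC1TableF128r.N0) ≤ 1.011 := by
  have hπ := Real.pi_lt_d4
  norm_num [klC1TableF128r]
  nlinarith [hπ]

/-- `d = 512` (`n = 1`): `64·(Td + (π/2)N0) ≤ 0.16`. -/
theorem osc_coeff_table512_le : 16 * (4 : ℝ) ^ 1 * (klC1TableF512.Td + π / 2 * klC1TableF512.N0) ≤ 0.16 := by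
  have hπ := Real.pi_lt_d4
  norm_num [klC1TableF512]
  nlinarith [hπ]

/-- `d = 2048` (`n = 2`): `256·(Td + (π/2)N0) ≤ 0.255`. -/
theorem osc_coeff_table2048_le : 16 * (4 : ℝ) ^ 2 * (klC1TableF2048.Td + π / 2 * klC1TableF2048.N0) ≤ 0.255 := by
  have hπ := Real.pi_lt_d4
  norm_num [klC1TableF2048]
  nlinarith [hπ]

/-- `d = 8192` (`n = 3`): `1024·(Td + (π/2)N0) ≤ 0.171`. -/
theorem osc_coeff_table8192_le : 16 * (4 : ℝ) ^ 3 * (klC1TableF8192.Td + π / 2 * klC1TableF8192.N0) ≤ 0.171 := by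
  have hπ := Real.pi_lt_d4
  norm_num [klC1TableF8192]
  nlinarith [hπ]

/-- `d = 32768` (`n = 4`): `4096·(Td + (π/2)N0) ≤ 0.253`. -/
theorem osc_coeff_table32768_le : 16 * (4 : ℝ) ^ 4 * (klC1TableF32768.Td + π / 2 * klC1TableF32768.N0) ≤ 0.253 := by
  have hπ := Real.pi_lt_d4
  norm_num [klC1TableF32768]
  nlinarith [hπ]

/-- **The table branch's (C1) clause share is `≤ 1.011·(cc₁ + cc′₁|U|)` at every `n ≤ 4`** (the five numerals in one line). -/
theorem osc_coeff_tables_le :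
    16 * (4 : ℝ) ^ 0 * (klC1TableF128r.Td + π / 2 * klC1TableF128r.N0) ≤ 1.011 ∧
    16 * (4 : ℝ) ^ 1 * (klC1TableF512.Td + π / 2 * klC1TableF512.N0) ≤ 1.011 ∧
    16 * (4 : ℝ) ^ 2 * (klC1TableF2048.Td + π / 2 * klC1TableF2048.N0) ≤ 1.011 ∧
    16 * (4 : ℝ) ^ 3 * (klC1TableF8192.Td + π / 2 * klC1TableF8192.N0) ≤ 1.011 ∧
    16 * (4 : ℝ) ^ 4 * (klC1TableF32768.Td + π / 2 * klC1TableF32768.N0) ≤ 1.011 :=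
  ⟨osc_coeff_table128r_le, osc_coeff_table512_le.trans (by norm_num), osc_coeff_table2048_le.trans (by norm_num),
    osc_coeff_table8192_le.trans (by norm_num), osc_coeff_table32768_le.trans (by norm_num)⟩

end Summit.HubbardSuperconductivity.HubbardSuperconductivity.Theorems.KLRegimeSplit

end
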